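import Summits.QuantumFields.BalabanUV.T4Continuum.Support.ShellMeasureLandauEndAssembledDecayReachToy
import Summits.QuantumFields.BalabanUV.T4Continuum.Support.ShellMeasureLandauEndAssembledBlockP4

/-!
# `T4Continuum.ShellMeasureLandauEndAssembledDecayReachBlockP4` — row S80 f8 «(P4) JOINTLY ON THE ONE-SLOT END OF RECORD»: S80 f6
# `…ReachBox.…_of_core_collar` FIRED BY NAME on S80 f7's corner datum WITH (T1) := S77 R10's block field space, `hW` := OUR
# action's (P4) binder `blockW_prop4Hyp`, the propagator letter NON-ZERO
(cell `pub-balaban`, sub-cell `t4`, spine estimate NE7c (node U5b); NE7c ROUND-2 crew, unit `b2b-balaban-t4-ne7c-formalise-leaf-03`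
gen 8; journal OFFER l.20777; ADDITIVE — imports S80 f7 `ShellMeasureLandauEndAssembledDecayReachToy` (this lineage: the corner
datum, `toyF7`, `toyJco7`, `readOut7`, `hcore_toy`∕`hcollar_toy`; hence S80 f6 — the MOST-ASSEMBLED ONE-SLOT DECLARATION OF RECORD,
R-ne7cp1-g34-4 (a)) and S77 R10 f2 `ShellMeasureLandauEndAssembledBlockP4` (leaf-02-g10: `rdL_solAt_eq_zero`; hence R10 f1: `𝕐`,
`𝕎`, `blockW`, `blockW_prop4Hyp`, `rdL`, `𝒢L`, `norm_le_of_letters`, `εθ₁`) ONLY, every supplier BY NAME; [folklore]; ONE data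
`def` (`embOf` — R10's `embL` at an arbitrary read-out letter), 0 `def … : Prop`, 0 sorry, 0 citation tags)

HONEST FRAMING.  A CONSISTENCY CERTIFICATE (crew rule G-1) — nothing about Bałaban's minimiser, propagators, kernels or densities.
Finite four-torus programme, rung (B)+1 only — NOT infinite volume, NOT a mass gap, NOT the Clay problem, NOT summit progress; NE7c
(`T4IndicatorShell.ShellWeightBound`) NOT PRINTED in [Balaban 1983–89], NOT PROVED; «NE7c ⇐ the named binders» (trigger c3); (M1)
realized on a toy ≠ NE7c; nothing of Bałaban's asserted or discharged; NOTHING in the countdown moves; spine PROVED 0∕9.  HONEST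
DEPENDENCY (cell): continuum YM on T⁴ ⇐ BetaPertH ∧ nine spine estimates (0/9 proved); BetaPertH ⇐ (D1) ∧ (D4) ∧ CAP+tail;
G-an2-4 gates asym, D1 and NE2/3/4.

WHY (crew referee PASS 22 (ii) ∕ PASS 24 «(P4) second half»; t4-ref2 C-t4r2-386 caveat (ii)): the (P4) letter `hW` of the END
is to be inhabited by OUR action TOGETHER WITH the other (T1) binders ON THE SAME `𝒴∕𝒵`.  S77 R10 f2 does it for the host
S80 f3 on S88's datum (`T := ∅`); S80 f7 fires the declaration OF RECORD S80 f6 (γ3 PAIR + box + comb gauge) with `W𝒱 = 0`.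
THIS FILE joins them — ONE example in which every binder family of the one-slot declaration of record that has a
non-degenerate witness anywhere in the tree is non-degenerate AT ONCE:
* §1 `embOf dB r η` — a read-out letter at the FIRST moving bond of R10's block (`rdL_embOf`, `norm_embOf_le ≤ (6∕η)‖y‖`);
* §2 **`slotAC_core_collar_blockP4_lit`** ∕ **`slotAC_core_collar_blockP4`** (clean `4·m₀`): S80 f6 APPLIED BY NAME — γ3 side
  := S80 f7 VERBATIM; (T1) := S77 R10 VERBATIM up to the letter (**`W𝒱 := blockW dB η`, `hW := blockW_prop4Hyp`**, `C₄ := C₄c dB`,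
  **`𝒢 := 𝒢L dB η (B₀η∕2) ≠ 0`**, `H₁ := (B₀∕E₀)•embOf (readOut7 lo e)`, `Φ := (E₀∕B₀)•id`, R10's numbers and threshold `εθ₁ S η`);
  (T2)∕(T3)∕(S78) := S80 f4's degenerate data; the dictionary READ THROUGH THE BLOCK SPACE (`rdL (embOf r (cplx x)) = gen x`,
  `rdL (solAt …) = 0` by R10 f2 `rdL_solAt_eq_zero` — the minimiser correction a GENUINE B11-Prop-6 fixed point FED BY `blockW`);
* §3 `εθ₁_eta_sq_le_sin_half` (`S ≤ η²∕3·10⁶ ⟹ εθ₁ S η·η² ≤ sin(S∕2)`, exact arithmetic + Jordan) and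
  **`slotAC_core_collar_blockP4_concrete`**: `toyParams` (`d = 2`), level `0`, corner `0`, `dB = 4`, `η = ½`, `S = 10⁻⁸`,
  `a = sin(S∕2)`, `ρ = 1∕20` — NO hypothesis left.
NOT DONE HERE: (T2)∕(T3) (zero kernels — C-t4r2-386 caveat (i) STANDS); the Landau correction (`Cf = Hop = ιs = 0`); a slot live
at the threshold; Bałaban's η-scalings of the read-outs (one slot); anything of Bałaban's.  NE7c NOT PROVED; spine PROVED 0∕9.
-/

noncomputable section

open Set Metric NormedSpace MeasureTheory Function

namespace Summit.QuantumFields.BalabanUV.T4Continuum.ShellMeasureLandauEndAssembledDecayReachBlockP4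

open scoped ENNReal Matrix.Norms.L2Operator
open Literature.MathematicalPhysics.QuantumFieldTheory.Balaban1983to89
open GaugeField (GaugeInvariant plaqHol)
open T4CubeChartGnomonic (SU2)
open T4TreeGaugeFixing (NoClosedLoop fixTo noClosedLoop_combBonds)
open T4AxialGaugeFixing (combBonds)
open T4AxialGaugeSmallField (boxPlaqs boxBonds)
open T4CubePoincare (cube)
open T4CubeChartExp (expFibreChart)
open T4ExpWindowSmallField (dist1_expPt_eq dist1_eq_norm_coe_sub_one)
open ShellMeasureWilsonRealizedSU2 (wilsonU M₂ gen coe_chart gen_mem_skewAdjoint)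
open B11Prop6Scheme (Prop4Hyp)
open T4ShellMeasure (SlotAntiConcentration)
open T4ShellMeasurePlaquette (expTail₂)
open ShellMeasureLevelAssembly (classifier)
open ShellMeasureWilsonWords (wordExp wordExp_cons wordExp_nil)
open ShellMeasureMultiGridNormsMax (WMax)
open ShellMeasureCommutatorCovDatum (covIdx unitW)
open ShellMeasurePlaquetteCubicFrozenBox (boxΛ)
open ShellMeasureDecayKernelSums (kerOp)
open ShellMeasureLandauHolonomy (solAt landauExp)
open ShellMeasureLandauHolonomyChart (cplx holOf holOf_apply norm_cplx_le)
open ShellMeasureLandauHolonomySkew (readOutReal)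
open ShellMeasureLandauEndFinalToy (toyU measurable_toyU gaugeInvariant_toyU smul_mem_cube landauExp_zero)
open ShellMeasureLandauEndAssembledToy (norm_kerOp_zero_le)
open ShellMeasureLandauEndAssembledDecayReachBox (slotAC_realized_su2_landauChart_assembled_decay_of_core_collar)
open ShellMeasureLevelZeroBoxWitness (toyParams toyParams_sitesPerDir dir_zero_lt_one side_two_side side_two_nonwrapping)
open ShellMeasureLandauEndAssembledDecayReachToyData (b₀ p₀ reset singleton_box singleton_comb plaqHol_p₀_sec readOut7
  norm_readOut7_le readOut7_cplx)
open ShellMeasureLandauEndAssembledDecayReachToy (toyF7 toyJco7 measurable_toyF7 gaugeInvariant_toyF7 toyF7_le_one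
  toyF7_one hcore_toy hcollar_toy toyF7_section_mono)
open ShellMeasureLandauEndBlockSpace (mv₂ c₀ wY DvY 𝕐 𝕎 blockW C₄c C₄c_nonneg blockW_prop4Hyp embL rdL 𝒢L rdL_𝒢L norm_rdL_le
  norm_le_of_letters norm_𝒢L_le real_smul_mem_skewAdjoint εθ₁ εθ₁_pos)
open ShellMeasureLandauEndAssembledBlockP4 (rdL_solAt_eq_zero)

variable {P : Params} {j : ℕ}

/-! ## §1 A read-out letter placed at the first moving bond of R10's block -/

section Emb
variable (dB : ℕ) [NeZero dB]

/-- THE EMBEDDING of chart coordinates into R10's block space `𝕐 dB η` through a read-out letter `r : ℂ^{m₀} →L M₂(ℂ)` placed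
at the FIRST moving bond (zero at the second) — R10 f1's `embL` with S88's `toyReadOut p e` replaced by `r`. [folklore] -/
def embOf {m₀ : ℕ} (r : (Fin m₀ → ℂ) →L[ℂ] M₂) (η : ℝ) : (Fin m₀ → ℂ) →L[ℂ] 𝕐 dB η :=
  ((WMax.toPiL (wY dB) (unitW ↥(covIdx (boxΛ dB))) (DvY dB η)).symm : (↥(mv₂ dB) → M₂) →L[ℂ] 𝕐 dB η).comp
    ((ContinuousLinearMap.single ℂ (fun _ : ↥(mv₂ dB) => M₂) (c₀ dB)).comp r)

/-- Unfolding: the embedded field is `Pi.single c₀ (r y)`. [folklore] -/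
theorem embOf_apply {m₀ : ℕ} (r : (Fin m₀ → ℂ) →L[ℂ] M₂) (η : ℝ) (y : Fin m₀ → ℂ) :
    (show ↥(mv₂ dB) → M₂ from embOf dB r η y) = Pi.single (c₀ dB) (r y) := rfl

/-- R10 f1's `embL` IS `embOf` at S88's letter. [folklore] -/
example {p : Plaq P j} {m₀ : ℕ} (e : ↥({ShellMeasureLandauEndFinalToy.b₁ p} : Finset (PBond P j)) × Fin 3 ≃ Fin m₀)
    (η : ℝ) : embL dB p e η = embOf dB (ShellMeasureLandauEndFinalToy.toyReadOut p e) η := rfl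

/-- The read-out (evaluation at the first moving bond) of the embedded field is the letter. [folklore] -/
theorem rdL_embOf {m₀ : ℕ} (r : (Fin m₀ → ℂ) →L[ℂ] M₂) (η : ℝ) (y : Fin m₀ → ℂ) :
    rdL dB η (embOf dB r η y) = r y := by
  show (show ↥(mv₂ dB) → M₂ from embOf dB r η y) (c₀ dB) = _; rw [embOf_apply, Pi.single_eq_same]

/-- The letters of the embedded field are bounded by the letter `r y`. [folklore] -/
theorem norm_embOf_letter_le {m₀ : ℕ} (r : (Fin m₀ → ℂ) →L[ℂ] M₂) (η : ℝ) (y : Fin m₀ → ℂ) (c : ↥(mv₂ dB)) :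
    ‖(show ↥(mv₂ dB) → M₂ from embOf dB r η y) c‖ ≤ ‖r y‖ := by
  rw [embOf_apply]; rcases eq_or_ne c (c₀ dB) with rfl | h
  · rw [Pi.single_eq_same]
  · rw [Pi.single_eq_of_ne h, norm_zero]; exact norm_nonneg _

/-- **THE EMBEDDING IS BOUNDED BY `6∕η`** whenever the letter is bounded by `3` (R10 f1 `norm_le_of_letters`). [folklore] -/
theorem norm_embOf_le {m₀ : ℕ} {r : (Fin m₀ → ℂ) →L[ℂ] M₂} (hr : ∀ y, ‖r y‖ ≤ 3 * ‖y‖) {η : ℝ} (hη : 0 < η)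
    (hη1 : η ≤ 1) (y : Fin m₀ → ℂ) : ‖embOf dB r η y‖ ≤ 6 / η * ‖y‖ := by
  have h := norm_le_of_letters dB hη hη1 (embOf dB r η y) (K := 3 * ‖y‖) (by positivity)
    (fun c => (norm_embOf_letter_le dB r η y c).trans (hr y))
  calc ‖embOf dB r η y‖ ≤ 2 / η * (3 * ‖y‖) := h
    _ = 6 / η * ‖y‖ := by ring

end Emb

/-! ## §2 S80 f6 FIRED BY NAME: S80 f7's γ3 datum × S77 R10's block-space (T1) with `hW := blockW_prop4Hyp` -/

section Fire
variable [DecidableEq (PBond P j)]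

/-- **«(P4) JOINTLY ON THE ONE-SLOT END OF RECORD» (literal slot constant)** — S80 f6 `…ReachBox.…_of_core_collar` APPLIED
BY NAME: γ3 side := S80 f7's corner datum (`T := combBonds ≠ ∅`, `Λ := {b₀}`, centre `1`, `toyU p₀`, `toyF7`, `toyJco7`,
`hcore_toy`, `hcollar_toy`); (T1) := S77 R10's block space (`𝒴 := 𝕐 dB η`, `𝒵 := 𝕎 dB`, `W𝒱 := blockW dB η`,
**`hW := blockW_prop4Hyp`**, `𝒢 := 𝒢L dB η (B₀η∕2) ≠ 0`, `H₁ := (B₀∕E₀)•embOf (readOut7 lo e)`, `Φ := (E₀∕B₀)•id`, `ℓs () = [rdL]`);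
(T2)∕(T3)∕(S78) := S80 f4's degenerate data — EVERY binder met; five symbolic numbers left (`η`, `S`, `ρ`, `a`, `dB`).  A
consistency certificate; nothing of Bałaban's; NE7c NOT PROVED. [folklore] -/
theorem slotAC_core_collar_blockP4_lit (lo : Fin P.d → ℤ) {i₀ i₁ : Fin P.d} (h01 : i₀ < i₁)
    (h3 : 3 ≤ P.sitesPerDir j) {m₀ : ℕ} (e : ↥({b₀ lo i₀ i₁} : Finset (PBond P j)) × Fin 3 ≃ Fin m₀)
    (dB : ℕ) [NeZero dB] (hd2 : 2 ≤ dB) {η S ρ a : ℝ} (hη : 0 < η) (hη1 : η ≤ 1) (hS : 0 < S) (hSη : S < η / 192)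
    (hρ0 : 0 ≤ ρ) (hρ4 : ρ ≤ 1 / 4) (ha : 0 < a)
    (hrad : ((P.d - 1 : ℕ) : ℝ) * (2 : ℕ) * a ≤ 2 * Real.sin (S / 2)) (hθa : εθ₁ S η * η ^ 2 ≤ a) :
    SlotAntiConcentration ((fieldMeasure P j SU2).withDensity (toyF7 lo h01 a)) (toyU (p₀ lo i₀ i₁ h01)) (εθ₁ S η * η ^ 2) ρ
      (2 * ((m₀ : ℝ) + (3 * (|(0:ℝ)| * ((0 +
                2 * (1 * (0 * 1 * (1/6) / ((1 - 0 * 1 * (2 * 0 * (2/3) * Real.exp (0 * 0))) *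
                    (1 - 2 * 0 * 2 * Real.exp (0 * 0) * (0 * 1) * (0 * 1)))) +
                  expTail₂ (((1:ℕ):ℝ) * (1 * (0 * 1 * (1/6) / ((1 - 0 * 1 * (2 * 0 * (2/3) * Real.exp (0 * 0))) *
                    (1 - 2 * 0 * 2 * Real.exp (0 * 0) * (0 * 1) * (0 * 1))))))) / ((1/3) / S)) *
                (2 * (1 * (0 * 1 * (1/6) / ((1 - 0 * 1 * (2 * 0 * (2/3) * Real.exp (0 * 0))) *
                    (1 - 2 * 0 * 2 * Real.exp (0 * 0) * (0 * 1) * (0 * 1)))) +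
                  expTail₂ (((1:ℕ):ℝ) * (1 * (0 * 1 * (1/6) / ((1 - 0 * 1 * (2 * 0 * (2/3) * Real.exp (0 * 0))) *
                    (1 - 2 * 0 * 2 * Real.exp (0 * 0) * (0 * 1) * (0 * 1))))))) / ((1/3) / S))) * 1) +
              (3 * (0 * (2 * (((1/6) + 1 * (1/6)) + 1 * (4 * 0 * ((1/6) + 1 * (1/6)) ^ 2)))) / ((1/3) / S - 1) + 0))) / (1 - 1/2)) := by
  have hd1 : 1 ≤ dB := by omega
  have h0B : (0 : Fin dB) ≠ 1 := fun h => by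
    have h' := congrArg Fin.val h
    rw [Fin.val_zero, Fin.val_one', Nat.mod_eq_of_lt (by omega)] at h'; exact absurd h' (by norm_num)
  have hSπ : 3 * S ^ 2 < Real.pi ^ 2 := by nlinarith [Real.pi_gt_three]
  have hC := C₄c_nonneg dB hd1
  have hs0 : 0 ≤ 1 / (C₄c dB + 1) * η / 2 := by positivity
  have h𝒢B : ∀ f : 𝕎 dB, ‖𝒢L dB η (1 / (C₄c dB + 1) * η / 2) f‖ ≤ 1 / (C₄c dB + 1) * ‖f‖ := fun f =>
    (norm_𝒢L_le dB hη hη1 hs0 f).trans (le_of_eq (by field_simp))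
  have hB₀ : 0 < 1 / (C₄c dB + 1) := by positivity
  have hN := side_two_nonwrapping h3 lo
  refine slotAC_realized_su2_landauChart_assembled_decay_of_core_collar (P := P) (j := j) (n := Fin 2)
    (𝒴 := 𝕐 dB η) (𝒴' := 𝕐 dB η) (𝒳 := Fin m₀ → ℂ) (𝒵 := 𝕎 dB) (ℬ := Fin m₀ → ℂ) (ι := Unit)
    (Pu := {()}) (δ := 1 / 2) (ρ := ρ) (β := 0) (B₀ := 1 / (C₄c dB + 1)) (C₄ := C₄c dB) (a₃ := 1 / 8) (ε₄ := 1 / 32)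
    (dL := 1) (C₁ := 1) (B₃ := 1) (ε₁ := (C₄c dB + 1) / 64) (rΦ := η / 192) (C₂ := 0) (RC := 1) (ε₃ := 1 / 16) (κr := 1)
    (m := 1) (κc := 1) (Λw := Unit) (Λz := Unit) (Λw' := Unit) (Λx := Unit) (Λb := Unit) (𝔖 := Unit) (𝔄w := ℂ) (ℭ := ℂ) (𝔄' := ℂ)
    (𝔅 := ℂ) (𝔇 := ℂ) (δw := 0) (c𝒢 := 0) (δ𝒢 := 0) (M𝒢 := 1) (cι := 0) (δι := 0) (Mι := 1) (cH := 0) (δH := 0)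
    (MH := 1) (cH₁ := 0) (δH₁ := 0) (MH₁ := 1) (B₀w := 1) (C₄w := 0) (a₃w := 2 / 3) (ε₄w := 1 / 6) (bw := 1 / 6)
    (rΦw := 1 / 3) (C₂w := 0) (RCw := 2) (rW := 0) (rC := 0) (𝔭 := Unit) (κwb := 1) (κcb := 1) (mw := 1)
    (d := fun _ => 0) (dbar := 0) (Kw := 1) (Λe := Unit) (𝔄 := ℂ) (δ' := 0) (ϖ := fun _ => 0) (𝒴e' := ℂ) (𝒳e := ℂ)
    (𝒵e := ℂ) (ℬe := ℂ) (B₀e := 1) (C₄e := 0) (a₃e := 2 / 3) (be := 1 / 6) (ε₄e := 1 / 6) (rΦe := 1 / 3) (C₂e := 0)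
    (RCe := 1) (𝔱 := Unit) (Ef := fun _ _ => 0) (rE := 1) (ee := fun _ => 0) (LK := 0) (BE₁ := 0) (Ω := Unit)
    (g := fun _ => 1) (Bd := 0) (BE₂ := 0) (η := η) (εθ := εθ₁ S η) (c₁ := 1 / (16 * η ^ 2)) (c₂ := 1 / (16 * η))
    (z := 1) (a := a) (Pcore := ({p₀ lo i₀ i₁ h01} : Set (Plaq P j))) (Pcollar := boxPlaqs lo (fun κ => lo κ + 2)) (side_two_side lo)
    hN {b₀ lo i₀ i₁} (singleton_box hN h01) (singleton_comb hN h01) e hS hSπ (measurable_toyF7 lo h01 a)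
    (gaugeInvariant_toyF7 lo h01 a) (measurable_toyU (p₀ lo i₀ i₁ h01)) (gaugeInvariant_toyU (p₀ lo i₀ i₁ h01))
    (Finset.singleton_nonempty ()) (fun _ => cube m₀ S) (toyJco7 lo h01 e S a)
    -- ══ (T1) ON THE BLOCK SPACE (S77 R10): `𝒢 := 𝒢L` (NON-ZERO), `W𝒱 := blockW`, `hW := blockW_prop4Hyp` ══
    (fun _ => 𝒢L dB η (1 / (C₄c dB + 1) * η / 2)) (fun _ => blockW dB η) (fun _ f => h𝒢B f)
    (fun _ => blockW_prop4Hyp dB hd1 hη hη1) hB₀ hC (by norm_num)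
    zero_le_one zero_le_one (by positivity) le_rfl ?_ (by norm_num) ?_
    (fun _ => (((1 / (C₄c dB + 1)) / (6 / η) : ℝ) : ℂ) • embOf dB (readOut7 lo e) η) ?_
    (fun _ z => (((6 / η) / (1 / (C₄c dB + 1)) : ℝ) : ℂ) • z)
    (fun _ => ((((((6 / η) / (1 / (C₄c dB + 1)) : ℝ) : ℂ) •
        ContinuousLinearMap.id ℂ (Fin m₀ → ℂ)).differentiable.differentiableOn).congr fun z _ => rfl))
    (fun _ => smul_zero _) ?_ hSη
    (fun _ _ => 0) le_rfl (fun _ Z _ => by simp) (fun _ => differentiableOn_const _)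
    (fun _ => 0) (fun _ Y => by simp) (fun _ => 0)
    (fun _ X => by rw [zero_apply, norm_zero]; exact mul_nonneg hB₀.le (norm_nonneg X))
    (by norm_num) ?_ (by norm_num)
    (fun _ => [rdL dB η]) zero_le_one
    (fun _ _ ℓ hℓ Y => by rw [List.mem_singleton.1 hℓ, one_mul]; exact norm_rdL_le dB η Y)
    (fun _ _ => by simp) zero_le_one
    (fun _ _ Y => by simpa using norm_rdL_le dB η Y)
    -- ══ (T2)∕(T3)∕(S78): S80 f4's degenerate-but-legal data VERBATIM (as in S80 f7) ══
    le_rfl (fun _ => 0) (fun _ _ => 0)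
    (fun _ _ => by simp) id id id id id (fun _ _ _ => 0) (fun _ _ _ => 0) (fun _ _ _ => 0) (fun _ _ _ => 0) le_rfl
    zero_le_one (fun _ _ _ => by simp) (fun _ => by simp) le_rfl zero_le_one (fun _ _ _ => by simp)
    (fun _ => by simp) le_rfl zero_le_one (fun _ _ _ => by simp) (fun _ => by simp) le_rfl zero_le_one
    (fun _ _ _ => by simp) (fun _ => by simp) (fun _ _ => 0) (fun _ f => norm_kerOp_zero_le zero_le_one f)
    (fun _ => ⟨fun Y _ => by simp, differentiableOn_const _⟩) one_pos le_rfl (by norm_num) (by norm_num)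
    (by norm_num) (by norm_num) (fun _ B => norm_kerOp_zero_le zero_le_one B) (fun _ _ => 0)
    (fun _ => differentiableOn_const _) (fun _ => rfl) (fun _ z _ => by simp) (by linarith) (fun _ _ => 0) le_rfl
    (fun _ Z _ => by simp) (fun _ => differentiableOn_const _)
    (fun _ Y => by simpa using norm_kerOp_zero_le zero_le_one Y) (fun _ X => norm_kerOp_zero_le zero_le_one X)
    (by norm_num) (by norm_num) (fun _ _ => True) (fun _ A A' c' _ => rfl) (fun _ _ _ => by simp) (fun _ _ => True)
    (fun _ A A' c' _ => rfl) (fun _ _ _ => by simp) (fun _ z i _ => rfl) (by norm_num) (by norm_num) {()}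
    (fun _ => [0]) (fun _ => ∅) (fun _ => 0) (fun _ _ ℓ _ A A' _ => by simp_all)
    (fun _ _ b' hb' => absurd hb' (Finset.notMem_empty _)) (fun _ _ => le_rfl) zero_le_one zero_le_one
    (fun _ _ ℓ hℓ => by rw [List.mem_singleton.1 hℓ]; exact ContinuousLinearMap.opNorm_le_bound _ zero_le_one fun Y => by simp)
    (fun _ _ => by
      rw [List.sum_cons, List.sum_nil, add_zero]; exact ContinuousLinearMap.opNorm_le_bound _ zero_le_one fun Y => by simp)
    (fun _ _ => by simp) ⊤ (by simp) ⊤ ⊤ ⊤ (by simp) ⊤ (fun _ f _ => AddSubgroup.mem_top _)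
    (fun _ Y _ => AddSubgroup.mem_top _) (fun _ Y _ => AddSubgroup.mem_top _) (fun _ X _ => AddSubgroup.mem_top _)
    (fun _ Z _ => AddSubgroup.mem_top _) (fun _ B _ => AddSubgroup.mem_top _) (fun _ y _ => AddSubgroup.mem_top _)
    (fun _ _ ℓ hℓ Y _ => by rw [List.mem_singleton.1 hℓ]; simp) (fun _ _ => 1) (fun _ _ _ => (unitary _).one_mem)
    (fun _ _ _ => by simp) (fun _ _ => le_rfl) le_rfl (by simp) le_rfl (fun _ => le_rfl) (fun _ => 0) (fun _ _ => 0)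
    (fun _ f => by simp) (fun _ => ⟨fun Y _ => by simp, differentiableOn_const _⟩) one_pos le_rfl (by norm_num)
    (by norm_num) (by norm_num) (by norm_num) (by norm_num) (fun _ => 0) (fun _ B => by simp) (fun _ _ => 0)
    (fun _ => differentiableOn_const _) (fun _ => rfl) (fun _ z _ => by simp) (by linarith) (fun _ _ => 0) le_rfl
    (fun _ Z _ => by simp) (fun _ => differentiableOn_const _) (fun _ => 0) (fun _ Y => by simp) (fun _ => 0)
    (fun _ X => by simp) (by norm_num) (by norm_num) {()} one_pos (fun _ _ => differentiableOn_const _)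
    (fun _ _ Z _ => by simp) (fun _ _ => le_rfl) (fun _ => ∅) (fun _ _ A₁ A₂ _ => rfl) (fun _ => 0)
    (fun _ _ b' hb' => absurd hb' (Finset.notMem_empty _)) le_rfl (by simp) (by norm_num) (fun _ y _ => by simp)
    (Measure.dirac ()) (fun _ => zero_le_one) (fun _ _ _ => 0) le_rfl (fun _ x _ c' _ _ => by simp)
    (fun _ x _ c' _ _ => by simp) (fun _ x _ c' _ _ ω => by simp) (fun _ y _ => by simp)
    -- ══ the (T1) real structure ON THE BLOCK SPACE and S80 f7's dictionary READ THROUGH IT ══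
    {rdL dB η} ⊤ ⊤ ⊤ (by simp) (readOutReal {readOut7 lo e})
    (fun _ f _ => ?_) (fun _ Y _ => AddSubgroup.mem_top _) (fun _ Y _ => AddSubgroup.mem_top _) (fun _ X _ => by simp)
    (fun _ Z _ => AddSubgroup.mem_top _) (fun _ B hB => ?_) (fun _ y _ => ?_) (fun V x hx => ?_) (fun V x hxu => ?_)
    (fun V x hJ => ?_) (fun V x t ht => ?_) (fun V x => ?_)
    (fun _ => ShellMeasureLandauHolonomyPrint.chartCube_subset_closedBall hS.le)
    (by norm_num) (by norm_num) hρ0 (by linarith) le_rfl hη (εθ₁_pos hS hη hSη) ?_ ?_ ?_ ?_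
    -- ══ the γ3 PAIR + reach + cover (S80 f7's readings, THEOREMS about the toy) ══
    ha.le hrad (fun q hq => Or.inr hq) (hcore_toy lo h01 hθa) (hcollar_toy lo h01 hN ha)
  · -- `h1`: `2·B₀·C₁·B₃·ε₁ ≤ ε₄` — equality `1∕32`
    rw [show 2 * (1 / (C₄c dB + 1)) * 1 * 1 * ((C₄c dB + 1) / 64) = (1 : ℝ) / 32 by field_simp; ring]
  · -- `h3`: `16·B₀·C₄·ε₄ ≤ 1` with OUR `C₄`
    rw [show 16 * (1 / (C₄c dB + 1)) * C₄c dB * (1 / 32) = C₄c dB / (2 * (C₄c dB + 1)) by field_simp; ring]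
    rw [div_le_one (by positivity)]; linarith
  · -- `hH₁`: `‖(B₀∕E₀)•embOf r B‖ ≤ B₀‖B‖`
    intro V B
    rw [smul_apply, norm_smul, Complex.norm_real, Real.norm_of_nonneg (by positivity)]
    calc (1 / (C₄c dB + 1)) / (6 / η) * ‖embOf dB (readOut7 lo e) η B‖
        ≤ (1 / (C₄c dB + 1)) / (6 / η) * (6 / η * ‖B‖) :=
          mul_le_mul_of_nonneg_left (norm_embOf_le dB (norm_readOut7_le lo e) hη hη1 B) (by positivity)
      _ = 1 / (C₄c dB + 1) * ‖B‖ := by field_simp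
  · -- `hΦ`: `‖(E₀∕B₀)•z‖ < 2·dL·C₁·ε₁` on `‖z‖ < r_Φ`
    intro V z hz
    rw [mem_ball_zero_iff] at hz; rw [norm_smul, Complex.norm_real, Real.norm_of_nonneg (by positivity)]
    calc (6 / η) / (1 / (C₄c dB + 1)) * ‖z‖ < (6 / η) / (1 / (C₄c dB + 1)) * (η / 192) :=
          mul_lt_mul_of_pos_left hz (by positivity)
      _ = 2 * 1 * 1 * ((C₄c dB + 1) / 64) := by field_simp; ring
  · -- `hcoup`: `ε₄ + B₀·(2dLC₁ε₁) ≤ ε₃` — equality `1∕16`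
    rw [show (1 : ℝ) / 32 + 1 / (C₄c dB + 1) * (2 * 1 * 1 * ((C₄c dB + 1) / 64)) = 1 / 16 by field_simp; ring]
  · -- `h𝒢r`: the read-out never sees the propagator letter (`rdL ∘ 𝒢 = 0`)
    intro ℓ hℓ
    rw [Set.mem_singleton_iff.1 hℓ, rdL_𝒢L dB h0B]; exact (skewAdjoint M₂).zero_mem
  · -- `hH₁r`: the scaled embedded letter is read skew-adjoint when the chart letter is
    intro ℓ hℓ
    rw [Set.mem_singleton_iff.1 hℓ, smul_apply, map_smul, rdL_embOf]
    exact real_smul_mem_skewAdjoint (hB (readOut7 lo e) (Set.mem_singleton _)) _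
  · -- `hΦr`: `Φ (cplx y)` is read skew-adjoint by S80 f7's letter
    intro ℓ hℓ
    rw [Set.mem_singleton_iff.1 hℓ, map_smul, readOut7_cplx]
    exact real_smul_mem_skewAdjoint (gen_mem_skewAdjoint _ _ _ _) _
  · -- `hRdict`: `F(section x) = Jco V x · e^{−0}` on the cube — the three DEFINED profiles vanish on the degenerate data
    rw [toyJco7, indicator_of_mem hx]; simp
  · -- `hudict`: S80 f7's dictionary READ THROUGH THE BLOCK SPACE — `rdL (H₁ (Φ (cplx x))) = gen x`, `rdL (solAt …) = 0`
    have hsc : ((((1 / (C₄c dB + 1)) / (6 / η) : ℝ) : ℂ) • embOf dB (readOut7 lo e) η)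
        ((((6 / η) / (1 / (C₄c dB + 1)) : ℝ) : ℂ) • cplx x) = embOf dB (readOut7 lo e) η (cplx x) := by
      rw [smul_apply, map_smul, smul_smul, ← Complex.ofReal_mul,
        show (1 / (C₄c dB + 1)) / (6 / η) * ((6 / η) / (1 / (C₄c dB + 1))) = (1 : ℝ) by field_simp, Complex.ofReal_one,
        one_smul]
    -- the minimiser correction is a GENUINE fixed point fed by OUR `blockW`, and the read-out does not see it
    have hxS : ‖x‖ ≤ S := mem_closedBall_zero_iff.1 (ShellMeasureLandauHolonomyPrint.chartCube_subset_closedBall hS.le hxu)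
    have h𝔄 : ‖embOf dB (readOut7 lo e) η (cplx x)‖ < 1 / 32 :=
      calc ‖embOf dB (readOut7 lo e) η (cplx x)‖ ≤ 6 / η * ‖cplx x‖ := norm_embOf_le dB (norm_readOut7_le lo e) hη hη1 _
        _ ≤ 6 / η * S := mul_le_mul_of_nonneg_left ((norm_cplx_le x).trans hxS) (by positivity)
        _ < 6 / η * (η / 192) := mul_lt_mul_of_pos_left hSη (by positivity)
        _ = 1 / 32 := by field_simp; ring
    have hsol : rdL dB η (solAt (𝒢L dB η (1 / (C₄c dB + 1) * η / 2)) 0 (blockW dB η) (1 / 32) (0 : 𝕎 dB)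
        (embOf dB (readOut7 lo e) η (cplx x))) = 0 :=
      rdL_solAt_eq_zero dB h0B h𝒢B (blockW_prop4Hyp dB hd1 hη hη1) hB₀.le hC h𝔄 (by norm_num) (by norm_num)
        (by
          rw [show 1 / (C₄c dB + 1) * C₄c dB * (1 / 32 + 1 / 32) ^ 2 = C₄c dB / (256 * (C₄c dB + 1)) by field_simp; ring]
          rw [div_le_iff₀ (by positivity)]; nlinarith)
        (by
          rw [show 4 * (1 / (C₄c dB + 1)) * C₄c dB * (1 / 32 + 1 / 32) = C₄c dB / (4 * (C₄c dB + 1)) by field_simp; ring]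
          rw [div_lt_one (by positivity)]; linarith)
    rw [toyU, plaqHol_p₀_sec hN h01, dist1_eq_norm_coe_sub_one, coe_chart]
    simp only [classifier, Finset.sup'_singleton, holOf_apply, List.map_cons, List.map_nil, wordExp_cons, wordExp_nil,
      mul_one, landauExp_zero, hsc, map_add, hsol, zero_add, rdL_embOf, readOut7_cplx]
  · -- `hJW`: `Jco` lives on the cube
    by_contra h; exact hJ (indicator_of_notMem h _)
  · -- `hJ`: centre-monotone (S80 f7 `toyF7_section_mono`)
    unfold toyJco7; by_cases hx : x ∈ cube m₀ S
    · rw [indicator_of_mem hx, indicator_of_mem (smul_mem_cube hx ht)]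
      exact toyF7_section_mono lo h01 hN hSπ e a V hx ht
    · rw [indicator_of_notMem hx]; exact bot_le
  · -- `hJ1`
    unfold toyJco7; by_cases hx : x ∈ cube m₀ S
    · rw [indicator_of_mem hx]; exact toyF7_le_one lo h01 a _
    · rw [indicator_of_notMem hx]; exact bot_le
  · -- `hs₁`: curl read-out × field size — `1·(1∕16) ≤ (1∕(16η²))·η²·1`
    rw [show (1 : ℝ) * ((1 / 32 + 1 / (C₄c dB + 1) * (2 * 1 * 1 * ((C₄c dB + 1) / 64))) +
        1 / (C₄c dB + 1) * (4 * 0 * (1 / 32 + 1 / (C₄c dB + 1) * (2 * 1 * 1 * ((C₄c dB + 1) / 64))) ^ 2)) = 1 / 16 by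
      field_simp; ring]
    rw [show 1 / (16 * η ^ 2) * η ^ 2 * 1 = (1 : ℝ) / 16 by field_simp]
  · -- `ha`: letter size
    rw [show (1 : ℝ) * ((1 / 32 + 1 / (C₄c dB + 1) * (2 * 1 * 1 * ((C₄c dB + 1) / 64))) +
        1 / (C₄c dB + 1) * (4 * 0 * (1 / 32 + 1 / (C₄c dB + 1) * (2 * 1 * 1 * ((C₄c dB + 1) / 64))) ^ 2)) = 1 / 16 by
      field_simp; ring]
    rw [show 1 / (16 * η) * η * 1 = (1 : ℝ) / 16 by field_simp]
  · -- `hma`: regime `m·κ_r·a ≤ 1`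
    rw [show ((1 : ℕ) : ℝ) * (1 * ((1 / 32 + 1 / (C₄c dB + 1) * (2 * 1 * 1 * ((C₄c dB + 1) / 64))) +
        1 / (C₄c dB + 1) * (4 * 0 * (1 / 32 + 1 / (C₄c dB + 1) * (2 * 1 * 1 * ((C₄c dB + 1) / 64))) ^ 2))) = 1 / 16 by
      field_simp; ring]
    norm_num
  · -- `hsm`: (SM) with equality by the choice of `εθ₁`
    unfold εθ₁
    rw [show (1 : ℝ) / 2 * (72 * (1 / (16 * η ^ 2) * 1 + ((1 : ℕ) : ℝ) ^ 2 * (1 / (16 * η)) ^ 2 * 1 ^ 2) /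
        ((η / 192) / S - 1) ^ 2) = 36 * (1 / (16 * η ^ 2) * 1 + ((1 : ℕ) : ℝ) ^ 2 * (1 / (16 * η)) ^ 2 * 1 ^ 2) /
        ((η / 192) / S - 1) ^ 2 by ring]

/-- **«(P4) JOINTLY ON THE ONE-SLOT END OF RECORD» — CLEAN FORM**: slot constant `4·m₀`. [folklore] -/
theorem slotAC_core_collar_blockP4 (lo : Fin P.d → ℤ) {i₀ i₁ : Fin P.d} (h01 : i₀ < i₁)
    (h3 : 3 ≤ P.sitesPerDir j) {m₀ : ℕ} (e : ↥({b₀ lo i₀ i₁} : Finset (PBond P j)) × Fin 3 ≃ Fin m₀)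
    (dB : ℕ) [NeZero dB] (hd2 : 2 ≤ dB) {η S ρ a : ℝ} (hη : 0 < η) (hη1 : η ≤ 1) (hS : 0 < S) (hSη : S < η / 192)
    (hρ0 : 0 ≤ ρ) (hρ4 : ρ ≤ 1 / 4) (ha : 0 < a)
    (hrad : ((P.d - 1 : ℕ) : ℝ) * (2 : ℕ) * a ≤ 2 * Real.sin (S / 2)) (hθa : εθ₁ S η * η ^ 2 ≤ a) :
    SlotAntiConcentration ((fieldMeasure P j SU2).withDensity (toyF7 lo h01 a)) (toyU (p₀ lo i₀ i₁ h01)) (εθ₁ S η * η ^ 2) ρ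
      (4 * m₀) := by
  have h := slotAC_core_collar_blockP4_lit lo h01 h3 e dB hd2 hη hη1 hS hSη hρ0 hρ4 ha hrad hθa
  convert h using 2
  simp only [abs_zero, zero_mul, mul_zero, zero_div, zero_add, add_zero]
  ring

end Fire

/-! ## §3 Concrete numbers: `toyParams` (`d = 2`), `dB = 4`, `η = ½`, `S = 10⁻⁸`, `a = sin(S∕2)`, `ρ = 1∕20` -/

section Concrete

/-- **THE THRESHOLD FITS UNDER THE REACH**: `0 < η ≤ 1`, `0 < S ≤ η²∕(3·10⁶)` ⟹ `εθ₁ S η·η² ≤ sin(S∕2)` (`εθ₁ S η·η² =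
(153∕32)∕((η∕192)∕S − 1)² ≤ 705024·S²∕η² ≤ S∕4 ≤ (2∕π)(S∕2) ≤ sin(S∕2)`: exact arithmetic + Jordan `Real.mul_le_sin`). [folklore] -/
theorem εθ₁_eta_sq_le_sin_half {η S : ℝ} (hη : 0 < η) (hη1 : η ≤ 1) (hS : 0 < S) (hSη : S ≤ η ^ 2 / 3000000) :
    εθ₁ S η * η ^ 2 ≤ Real.sin (S / 2) := by
  have hη2 : η ^ 2 ≤ η := by nlinarith
  have hS1 : S ≤ η / 384 := by nlinarith
  have hj : S / 4 ≤ Real.sin (S / 2) := by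
    have h := Real.mul_le_sin (by linarith : 0 ≤ S / 2) (by nlinarith [Real.pi_gt_three] : S / 2 ≤ Real.pi / 2)
    have : S / 4 ≤ 2 / Real.pi * (S / 2) := by
      rw [div_mul_eq_mul_div, le_div_iff₀ Real.pi_pos]; nlinarith [Real.pi_le_four]
    linarith
  have hR : η / (384 * S) ≤ (η / 192) / S - 1 := by
    rw [div_div, le_sub_iff_add_le, div_add_one (by positivity), div_le_div_iff₀ (by positivity) (by positivity)]
    nlinarith
  have hnum : 72 * (1 / (16 * η ^ 2) * 1 + ((1 : ℕ) : ℝ) ^ 2 * (1 / (16 * η)) ^ 2 * 1 ^ 2) = (153 / 32) / η ^ 2 := by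
    field_simp; ring
  have h1 : εθ₁ S η ≤ ((153 / 32) / η ^ 2) / (η / (384 * S)) ^ 2 := by
    rw [εθ₁, hnum]
    exact div_le_div_of_nonneg_left (by positivity) (by positivity) (pow_le_pow_left₀ (by positivity) hR 2)
  have h2 : ((153 / 32) / η ^ 2) / (η / (384 * S)) ^ 2 * η ^ 2 = 705024 * S ^ 2 / η ^ 2 := by
    field_simp; ring
  have h3 : 705024 * S ^ 2 / η ^ 2 ≤ S / 4 := by
    rw [div_le_iff₀ (by positivity)]; nlinarith
  calc εθ₁ S η * η ^ 2 ≤ ((153 / 32) / η ^ 2) / (η / (384 * S)) ^ 2 * η ^ 2 :=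
        mul_le_mul_of_nonneg_right h1 (by positivity)
    _ = 705024 * S ^ 2 / η ^ 2 := h2
    _ ≤ Real.sin (S / 2) := h3.trans hj

/-- **THE WITNESS AT CONCRETE NUMBERS** — `toyParams` (`d = 2`, six sites per direction), level `0`, corner `0`, directions
`0 < 1`, every `e`; `dB = 4`, `η = ½`, `S = 10⁻⁸ < η∕192`, `a = sin(S∕2)` (so `(d−1)·2·a = 2 sin(S∕2)`; `εθ₁ S η·η² ≤ a` by
`εθ₁_eta_sq_le_sin_half`), `ρ = 1∕20`: S80 f6 FIRES with `hW := blockW_prop4Hyp` and `𝒢 ≠ 0` — NO hypothesis left. [folklore] -/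
theorem slotAC_core_collar_blockP4_concrete [DecidableEq (PBond toyParams 0)]
    (e : ↥({b₀ (P := toyParams) (j := 0) 0 ⟨0, by decide⟩ ⟨1, by decide⟩} : Finset (PBond toyParams 0)) × Fin 3 ≃ Fin 3) :
    SlotAntiConcentration ((fieldMeasure toyParams 0 SU2).withDensity
        (toyF7 (0 : Fin toyParams.d → ℤ) (dir_zero_lt_one le_rfl) (Real.sin ((1 / 100000000 : ℝ) / 2))))
      (toyU (p₀ (0 : Fin toyParams.d → ℤ) ⟨0, by decide⟩ ⟨1, by decide⟩ (dir_zero_lt_one le_rfl)))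
      (εθ₁ (1 / 100000000) (1 / 2) * (1 / 2 : ℝ) ^ 2) (1 / 20) (4 * (3 : ℕ)) := by
  have hS : (0 : ℝ) < 1 / 100000000 := by norm_num
  have hsin : 0 < Real.sin ((1 / 100000000 : ℝ) / 2) :=
    Real.sin_pos_of_pos_of_lt_pi (by norm_num) (by linarith [Real.pi_gt_three])
  have hrad : ((toyParams.d - 1 : ℕ) : ℝ) * (2 : ℕ) * Real.sin ((1 / 100000000 : ℝ) / 2) ≤
      2 * Real.sin ((1 / 100000000 : ℝ) / 2) := by
    simp only [toyParams, Nat.cast_ofNat]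
    norm_num
  exact slotAC_core_collar_blockP4 (P := toyParams) (j := 0) 0 (dir_zero_lt_one le_rfl)
    (by rw [toyParams_sitesPerDir]; norm_num) e 4 (by norm_num) (η := 1 / 2) (by norm_num) (by norm_num) hS (by norm_num)
    (by norm_num) (by norm_num) hsin hrad
    (εθ₁_eta_sq_le_sin_half (η := 1 / 2) (by norm_num) (by norm_num) hS (by norm_num))

end Concrete

end Summit.QuantumFields.BalabanUV.T4Continuum.ShellMeasureLandauEndAssembledDecayReachBlockP4

end
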